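import Summits.CriticalPhenomena.SAWScalingLimit.Theses.SAWDefectDecoherence
import Summits.CriticalPhenomena.SAWScalingLimit.Theorems.ObservableToSLE.Negative.Identification
import Summits.CriticalPhenomena.SAWScalingLimit.Theorems.ObservableToSLE.Negative.TightnessNecessity
import HarnessLib

/-!
# Route `SAWDefectDecoherence`: the assembly frame `Assembly` (stmt-CriticalPhenomena-14861) —
its exact content

The rev-20 assembly item of the route is the NON-GLUE frame

  `Assembly := DefectDecoherence → MassRatio → HexTight → HexTransfer → SAWScalingLimit`.

It deliberately omits the route's two implication cruxes `BoundaryClosureR`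
(stmt-CriticalPhenomena-14004: `DefectDecoherence → MassRatio → HexObservableLimitR`) and
`ObservableToSLER` (stmt-CriticalPhenomena-14005: `HexObservableLimitR → HexTight →` DCS
Conjecture 1 on the hexagonal lattice), so — unlike the deciding theorem `closes`, which binds all
six cruxes — it is not provable by logic alone.  This file records, kernel-checked against the live
route declarations, exactly what the frame is and what it needs beyond its own hypotheses:

* `sawDefectDecoherence_assembly_of_cruxes` — the planner's term: `BoundaryClosureR →
  ObservableToSLER → Assembly` (`fun hDD hMR hT hTr ↦ hTr (hO (hBC hDD hMR) hT)`); the item closes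
  in one line once both cruxes land;
* `sawDefectDecoherence_assembly_of_target` — the target `HexObservableLimitR` (rank 0) and
  `ObservableToSLER` already suffice (the exponent cruxes are then idle);
* `sawDefectDecoherence_assembly_of_hexConjecture` — DCS Conjecture 1 on the hexagonal lattice
  (the antecedent of `HexTransfer`; the shared item `HexConjecture`, stmt-CriticalPhenomena-0808)
  alone suffices (and so, trivially, does the `δℤ²` statement itself: the right disjunct of
  `sawDefectDecoherence_assembly_iff`);
* `sawDefectDecoherence_assembly_iff` — the propositional content: `Assembly` holds iff the two
  exponent estimates and eventual tightness give DCS Conjecture 1 on the hexagonal lattice OR the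
  `δℤ²` statement itself (classically `((P → Q) → Q) ↔ (P ∨ Q)`);
* `sawDefectDecoherence_assembly_iff_identification` — the sharpest form: since `HexTight` IS a
  hypothesis of the frame and the soft half of the convergence criterion is PROVED in the tree for
  the critical hexagonal SAW law (`ObservableToSLE.Negative.convergesInLawToSLE_of_identification`:
  Prokhorov along the mesh + uniqueness of the chordal SLE law, junk-`0` laws padded; converse
  `ObservableToSLE.Negative.isSLELaw_of_isSubseqLimitLaw`), the frame is EQUIVALENT to: the two
  exponent estimates and tightness imply the IDENTIFICATION of every subsequential weak limit law of
  the critical hexagonal SAW curve as the chordal SLE(8/3) law (or the `δℤ²` statement outright).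
  That identification is precisely the content the route splits into `BoundaryClosureR` +
  `ObservableToSLER`; the usable direction is `sawDefectDecoherence_assembly_iff_identification.mpr
  fun hDD hMR _ ↦ Or.inl (hId hDD hMR)` for any identification proof `hId`;
* the closers table (`sawDefectDecoherence_assembly_of_closer`: a refutation of any one of the
  three estimate hypotheses, or the `δℤ²` statement; `sawDefectDecoherence_not_assembly_iff`,
  `sawDefectDecoherence_assembly_iff_of_estimates`) — every single landed event that settles the
  item in one line, and the exact cost of a refutation;
* `sawDefectDecoherence_assembly_iff_tight_iff_conjecture` /
  `sawDefectDecoherence_assembly_iff_estimates_decide_tightness` — since tightness is NECESSARY for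
  convergence in law (`ObservableToSLE.Negative.isTightAlongMesh_of_convergesInLawToSLE`, giving
  `sawDefectDecoherence_hexTight_of_hexConjecture`), the frame is equivalent to: the two exponent
  estimates imply (`HexTight` ⇔ DCS Conjecture 1 on the hexagonal lattice), or the `δℤ²` statement.

No new definitions; propositional logic over the route declarations plus the three cited proved
lemmas.

## References

* H. Duminil-Copin, S. Smirnov, *The connective constant of the honeycomb lattice equals
  `√(2+√2)`*, Ann. of Math. 175 (2012), §4, Conjectures 1–2 [DuminilCopinSmirnov2012].
* P. Billingsley, *Convergence of Probability Measures*, 2nd ed. (1999), Thm. 5.1 and its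
  Corollary [BillingsleyCPM1999].
-/

noncomputable section

open MeasureTheory Filter Topology Set
open scoped NNReal ENNReal
open Literature.Probability.RandomPlanarGeometry Literature.Probability.RandomPlanarGeometry.SAW
open Literature.Probability.LatticeModels

namespace Summit.CriticalPhenomena.SAWScalingLimit.Theorems

open Summit.CriticalPhenomena.SAWScalingLimit.Theses.SAWDefectDecoherence

/-! ### One-line closers from existing items -/

/-- **The frame from the two implication cruxes** (the planner's intended proof of item
stmt-CriticalPhenomena-14861): `BoundaryClosureR` turns the exponent cruxes `DefectDecoherence`,
`MassRatio` into the target `HexObservableLimitR`, `ObservableToSLER` turns the target plus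
`HexTight` into DCS Conjecture 1 on the hexagonal lattice, and `HexTransfer` carries it to `δℤ²` —
the route's `closes` term with the two implication cruxes kept as hypotheses.
[cite: DuminilCopinSmirnov2012, §4 Conjectures 1–2] -/
theorem sawDefectDecoherence_assembly_of_cruxes (hBC : BoundaryClosureR) (hO : ObservableToSLER) :
    Assembly := by
  unfold Assembly
  intro hDD hMR hT hTr
  exact hTr (hO (hBC hDD hMR) hT)

/-- **The frame from the target and the identification crux**: if the repaired observable limit
`HexObservableLimitR` (the route's target, rank 0, item stmt-CriticalPhenomena-14003) holds
outright, `ObservableToSLER` alone closes the frame and the two exponent hypotheses are idle.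
[cite: DuminilCopinSmirnov2012, §4 Conjecture 2] -/
theorem sawDefectDecoherence_assembly_of_target (hX : HexObservableLimitR) (hO : ObservableToSLER) :
    Assembly := by
  unfold Assembly
  intro _ _ hT hTr
  exact hTr (hO hX hT)

/-- **The frame from DCS Conjecture 1 on the hexagonal lattice alone** (the shared item
`HexConjecture`, stmt-CriticalPhenomena-0808, here in the rendering of the sibling route
`SAWDevelopingMap`; verbatim the antecedent of `HexTransfer`): `HexTransfer` is simply applied and
the other three hypotheses are idle. [cite: DuminilCopinSmirnov2012, §4 Conjecture 1] -/
theorem sawDefectDecoherence_assembly_of_hexConjecture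
    (hH : Summit.CriticalPhenomena.SAWScalingLimit.Theses.SAWDevelopingMap.HexConjecture) :
    Assembly := by
  unfold Assembly HexTransfer
  unfold Summit.CriticalPhenomena.SAWScalingLimit.Theses.SAWDevelopingMap.HexConjecture at hH
  intro _ _ _ hTr
  exact hTr hH

/-! ### The exact content of the frame -/

/-- **Propositional content of the frame.** `Assembly` holds iff the two exponent estimates and
eventual tightness of the critical hexagonal SAW laws imply DCS Conjecture 1 on the hexagonal
lattice (verbatim the antecedent of `HexTransfer`) OR the `δℤ²` statement itself: classically
`((P → Q) → Q) ↔ (P ∨ Q)` with `P` = Conjecture 1, `Q` = `SAWScalingLimit`.  In particular the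
frame is not closable by logic over the route's items short of that disjunction. [folklore] -/
theorem sawDefectDecoherence_assembly_iff :
    Assembly ↔
      (DefectDecoherence → MassRatio → HexTight →
        (∀ (D : DobrushinDomain) (a b : ℝ → HexVertex),
          IsEmbEndpointApprox hexGraph hexCenter D a b →
            ConvergesInLawToSLE ((8 : ℝ≥0) / 3) D
              (fun δ (γ : HexDomainSAW D.carrier δ (a δ) (b δ)) => γ.curve)
              (fun δ => hexSAWLaw D.carrier δ (a δ) (b δ))) ∨ _root_.SAWScalingLimit) := by
  unfold Assembly HexTransfer
  constructor
  · intro h hDD hMR hT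
    refine (Classical.em _).imp id fun hC => ?_
    exact h hDD hMR hT fun hC' => absurd hC' hC
  · intro h hDD hMR hT hTr
    exact (h hDD hMR hT).elim hTr id

/-- **The frame is an identification statement.** Modulo results PROVED in the tree — the soft
half of the convergence criterion for the critical hexagonal SAW law
(`ObservableToSLE.Negative.convergesInLawToSLE_of_identification`: under an endpoint approximation,
tightness along `𝓝[>] 0` plus identification of the subsequential weak limit laws as chordal
SLE_κ laws give convergence in law to SLE_κ; Prokhorov, Billingsley's corollary to Thm. 5.1,
uniqueness of the SLE law) and its converse (`…isSLELaw_of_isSubseqLimitLaw`: a limit in law is the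
only subsequential limit law) — `Assembly` is EQUIVALENT to: `DefectDecoherence`, `MassRatio` and
`HexTight` imply that for every Dobrushin domain and hexagonal endpoint approximation every
subsequential weak limit law (a probability measure on `CurveClass ℂ`) of the critical hexagonal
SAW curve is the chordal SLE(8/3) law — or the `δℤ²` statement outright.  So beyond its own
hypotheses the item needs exactly an identification theorem, the content the route places in
`BoundaryClosureR` + `ObservableToSLER`; usable direction: `….mpr fun hDD hMR _ ↦ Or.inl (hId hDD hMR)`
for any proof `hId : DefectDecoherence → MassRatio → ⟨identification⟩`.
[cite: BillingsleyCPM1999, Thm. 5.1, Corollary] -/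
theorem sawDefectDecoherence_assembly_iff_identification :
    Assembly ↔
      (DefectDecoherence → MassRatio → HexTight →
        (∀ (D : DobrushinDomain) (a b : ℝ → HexVertex),
          IsEmbEndpointApprox hexGraph hexCenter D a b →
            ∀ μ : Measure (CurveClass ℂ), IsProbabilityMeasure μ →
              IsSubseqLimitLaw (fun δ (γ : HexDomainSAW D.carrier δ (a δ) (b δ)) => γ.curve)
                (fun δ => hexSAWLaw D.carrier δ (a δ) (b δ)) μ →
              IsSLELaw ((8 : ℝ≥0) / 3) D μ) ∨ _root_.SAWScalingLimit) := by
  rw [sawDefectDecoherence_assembly_iff]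
  refine forall₃_congr fun _ _ hT => or_congr_left ⟨fun h D a b hab μ hμ hsub => ?_,
    fun h D a b hab => ?_⟩
  · haveI := hμ
    exact ObservableToSLE.Negative.isSLELaw_of_isSubseqLimitLaw (h D a b hab) hsub
  · exact ObservableToSLE.Negative.convergesInLawToSLE_of_identification hab (hT D a b hab)
      (h D a b hab)

/-! ### The closers table

Together with the three closers above (`…_of_cruxes`: stmt-CriticalPhenomena-14004 + 14005;
`…_of_target`: 14003 + 14005; `…_of_hexConjecture`: 0808), the following completes the table of
SINGLE landed events that settle item stmt-CriticalPhenomena-14861 in one line from this file: the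
`δℤ²` statement itself (right disjunct of `sawDefectDecoherence_assembly_iff`), or a refutation of any
one of the three estimate hypotheses of the frame — `DefectDecoherence` (stmt-CriticalPhenomena-8549),
`MassRatio` (stmt-CriticalPhenomena-8550), `HexTight` (stmt-CriticalPhenomena-5423) — which closes it
vacuously (the fourth hypothesis `HexTransfer` cannot be refuted without refuting `SAWScalingLimit`). -/

/-- **The four cheap closers in one.** Each of the following settles the frame by itself: a
refutation of the vertex-star decoherence estimate `DefectDecoherence` (the route's first kill
criterion: defect exponent `θ ≤ 3/4` against the mass), a refutation of the positive two-point mass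
comparison `MassRatio` (bulk/boundary ratio beyond `δ^{-3/4}`), a refutation of the eventual
tightness `HexTight` (which would also refute DCS Conjecture 1 as typed, tightness being necessary
for convergence in law: `ObservableToSLE.Negative.isTightAlongMesh_of_convergesInLawToSLE`) — each
vacuously — or the `δℤ²` statement itself (all four hypotheses idle).  Usage for the closing file:
`theorem assembly_proof : Assembly := sawDefectDecoherence_assembly_of_closer (Or.inl not_dd)` etc.
[folklore] -/
theorem sawDefectDecoherence_assembly_of_closer
    (h : ¬ DefectDecoherence ∨ ¬ MassRatio ∨ ¬ HexTight ∨ _root_.SAWScalingLimit) : Assembly := by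
  unfold Assembly
  intro hDD hMR hT _
  rcases h with h | h | h | h
  · exact absurd hDD h
  · exact absurd hMR h
  · exact absurd hT h
  · exact h

/-- **The exact content of a refutation of the frame**: `¬ Assembly` holds iff the two exponent
estimates and eventual tightness all HOLD while both DCS Conjecture 1 on the hexagonal lattice
(written out; verbatim the antecedent of `HexTransfer`) and the `δℤ²` statement FAIL — a refutation
would have to PROVE `DefectDecoherence`, `MassRatio` and `HexTight` and decide the summit conjunct
negatively; no finite counterexample can do this. [folklore] -/
theorem sawDefectDecoherence_not_assembly_iff :
    ¬ Assembly ↔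
      (DefectDecoherence ∧ MassRatio ∧ HexTight ∧
        ¬ (∀ (D : DobrushinDomain) (a b : ℝ → HexVertex),
            IsEmbEndpointApprox hexGraph hexCenter D a b →
              ConvergesInLawToSLE ((8 : ℝ≥0) / 3) D
                (fun δ (γ : HexDomainSAW D.carrier δ (a δ) (b δ)) => γ.curve)
                (fun δ => hexSAWLaw D.carrier δ (a δ) (b δ))) ∧
        ¬ _root_.SAWScalingLimit) := by
  rw [sawDefectDecoherence_assembly_iff]
  constructor
  · intro h
    by_contra hc
    refine h fun hDD hMR hT => ?_
    by_contra hPS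
    exact hc ⟨hDD, hMR, hT, fun hP => hPS (Or.inl hP), fun hS => hPS (Or.inr hS)⟩
  · rintro ⟨hDD, hMR, hT, hP, hS⟩ h
    exact (h hDD hMR hT).elim hP hS

/-- **The residual goal with the three estimates standing**: given `DefectDecoherence`, `MassRatio`
and `HexTight`, the frame is exactly "DCS Conjecture 1 on the hexagonal lattice or the `δℤ²`
statement" — the joint content of the two implication cruxes `BoundaryClosureR`
(stmt-CriticalPhenomena-14004) and `ObservableToSLER` (stmt-CriticalPhenomena-14005), which give the
left disjunct. [folklore] -/
theorem sawDefectDecoherence_assembly_iff_of_estimates (hDD : DefectDecoherence) (hMR : MassRatio)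
    (hT : HexTight) :
    Assembly ↔
      ((∀ (D : DobrushinDomain) (a b : ℝ → HexVertex),
          IsEmbEndpointApprox hexGraph hexCenter D a b →
            ConvergesInLawToSLE ((8 : ℝ≥0) / 3) D
              (fun δ (γ : HexDomainSAW D.carrier δ (a δ) (b δ)) => γ.curve)
              (fun δ => hexSAWLaw D.carrier δ (a δ) (b δ))) ∨ _root_.SAWScalingLimit) := by
  rw [sawDefectDecoherence_assembly_iff]
  exact ⟨fun h => h hDD hMR hT, fun h _ _ _ => h⟩

/-! ### Tightness inside the frame: a hypothesis that its own conclusion implies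

`HexTight` is the one hypothesis of the frame that is a CONSEQUENCE of what the frame (short of the
`δℤ²` disjunct) concludes from it: convergence in law of the critical hexagonal SAW curve classes to
chordal SLE(8/3) implies their eventual tightness (Prokhorov's easy direction on the Polish space
`CurveClass ℂ`, proved in the tree as `ObservableToSLE.Negative.isTightAlongMesh_of_convergesInLawToSLE`).
Consequently the frame has an exact DICHOTOMY form with no dangling tightness hypothesis: under the two
exponent estimates, eventual tightness of the critical hexagonal SAW laws is EQUIVALENT to DCS
Conjecture 1 on the hexagonal lattice — or the `δℤ²` statement holds outright. -/

/-- **DCS Conjecture 1 on the hexagonal lattice (written out) implies `HexTight`** (this route's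
rendering of the shared item stmt-CriticalPhenomena-5423): tightness along the mesh is necessary for
convergence in law, domain by domain and endpoint approximation by endpoint approximation.
[cite: BillingsleyCPM1999, Thm. 5.1–5.2 (Prokhorov)] -/
theorem sawDefectDecoherence_hexTight_of_hexConjecture
    (hC : ∀ (D : DobrushinDomain) (a b : ℝ → HexVertex),
      IsEmbEndpointApprox hexGraph hexCenter D a b →
        ConvergesInLawToSLE ((8 : ℝ≥0) / 3) D
          (fun δ (γ : HexDomainSAW D.carrier δ (a δ) (b δ)) => γ.curve)
          (fun δ => hexSAWLaw D.carrier δ (a δ) (b δ))) :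
    HexTight := by
  unfold HexTight
  intro D a b hab
  exact ObservableToSLE.Negative.isTightAlongMesh_of_convergesInLawToSLE (hC D a b hab)

/-- **Dichotomy form of the frame.** `Assembly` holds iff, under the two exponent estimates
`DefectDecoherence` and `MassRatio`, eventual tightness of the critical hexagonal SAW laws is
EQUIVALENT to DCS Conjecture 1 on the hexagonal lattice (written out) — or the `δℤ²` statement holds
outright.  (`→`: if the `δℤ²` statement fails, the frame gives `HexTight →` Conjecture 1 and
`sawDefectDecoherence_hexTight_of_hexConjecture` the converse; `←`: immediate.)  So, granted the
line's two estimates, the shared tightness crux and the convergence conjecture stand or fall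
together inside this frame. [cite: BillingsleyCPM1999, Thm. 5.1–5.2 (Prokhorov)] -/
theorem sawDefectDecoherence_assembly_iff_tight_iff_conjecture :
    Assembly ↔
      (DefectDecoherence → MassRatio →
        (HexTight ↔
            ∀ (D : DobrushinDomain) (a b : ℝ → HexVertex),
              IsEmbEndpointApprox hexGraph hexCenter D a b →
                ConvergesInLawToSLE ((8 : ℝ≥0) / 3) D
                  (fun δ (γ : HexDomainSAW D.carrier δ (a δ) (b δ)) => γ.curve)
                  (fun δ => hexSAWLaw D.carrier δ (a δ) (b δ))) ∨ _root_.SAWScalingLimit) := by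
  rw [sawDefectDecoherence_assembly_iff]
  refine forall₂_congr fun _ _ => ⟨fun h => ?_, fun h hT => h.imp (fun hiff => hiff.1 hT) id⟩
  refine (Classical.em _root_.SAWScalingLimit).symm.imp (fun hS => ?_) id
  exact ⟨fun hT => (h hT).resolve_right hS, sawDefectDecoherence_hexTight_of_hexConjecture⟩

/-- **Tightness-free form of the frame.** Pulling the `δℤ²` disjunct out: `Assembly` holds iff the
two exponent estimates alone imply the equivalence "eventual tightness ⇔ DCS Conjecture 1 on the
hexagonal lattice", or the `δℤ²` statement holds.  In particular any proof of the frame that does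
not end in the `δℤ²` statement proves, from `DefectDecoherence` and `MassRatio`, that `HexTight` is
exactly as strong as Conjecture 1. [cite: BillingsleyCPM1999, Thm. 5.1–5.2 (Prokhorov)] -/
theorem sawDefectDecoherence_assembly_iff_estimates_decide_tightness :
    Assembly ↔
      ((DefectDecoherence → MassRatio →
          (HexTight ↔
            ∀ (D : DobrushinDomain) (a b : ℝ → HexVertex),
              IsEmbEndpointApprox hexGraph hexCenter D a b →
                ConvergesInLawToSLE ((8 : ℝ≥0) / 3) D
                  (fun δ (γ : HexDomainSAW D.carrier δ (a δ) (b δ)) => γ.curve)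
                  (fun δ => hexSAWLaw D.carrier δ (a δ) (b δ)))) ∨ _root_.SAWScalingLimit) := by
  rw [sawDefectDecoherence_assembly_iff_tight_iff_conjecture]
  refine ⟨fun h => ?_, fun h hDD hMR => h.imp (fun h' => h' hDD hMR) id⟩
  refine (Classical.em _root_.SAWScalingLimit).symm.imp (fun hS hDD hMR => ?_) id
  exact (h hDD hMR).resolve_right hS

end Summit.CriticalPhenomena.SAWScalingLimit.Theorems

end
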